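import Summits.MatrixMultiplication.OmegaCensus.SmallFormats.MatMul22nRankGF7Slack5Search
import HarnessLib

/-!
# ω-census family (a): replay of the slack-5 search certificate, CHECK A part 11 of 12 (elements `280 ≤ h < 308`)

Cell `pub-omega` (unit `pub-omega-tensor-g16`), topic `Summits/MatrixMultiplication/OmegaCensus` (sub-folder `SmallFormats`).
Framing (verbatim): lottery ticket; floor = certified bounds/negative ranges. HONEST FRAMING: machine-generated kernel replay
(`pub-omega-tensor-g16/code/gen5_runs.py`): `levelsOK5n h = true` for the elements `280 ≤ h < 308` of `PGL₂(7)`: for every slot `(c, h)`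
(`c < 656`) and bucket level, if the key of its column is visited then the bucket holds an entry with that column (SIMD key planes,
`MatMul22nRankGF7Plane`). Meaning: `slotOK5_of_levelsOK5` (`MatMul22nRankGF7Slack5SearchSound`). Nothing here is progress on `ω`.
-/

namespace Summit.MatrixMultiplication.OmegaCensus.SmallFormats

set_option Elab.async false

set_option maxRecDepth 100000 in
set_option maxHeartbeats 400000000 in
/-- Elements `280 ≤ h < 284`. -/
theorem levelsOK5_ok_280_284 : ∀ h : Fin 336, 280 ≤ h.val → h.val < 284 → levelsOK5n h.val = true := by decide +kernel

set_option maxRecDepth 100000 in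
set_option maxHeartbeats 400000000 in
/-- Elements `284 ≤ h < 288`. -/
theorem levelsOK5_ok_284_288 : ∀ h : Fin 336, 284 ≤ h.val → h.val < 288 → levelsOK5n h.val = true := by decide +kernel

set_option maxRecDepth 100000 in
set_option maxHeartbeats 400000000 in
/-- Elements `288 ≤ h < 292`. -/
theorem levelsOK5_ok_288_292 : ∀ h : Fin 336, 288 ≤ h.val → h.val < 292 → levelsOK5n h.val = true := by decide +kernel

set_option maxRecDepth 100000 in
set_option maxHeartbeats 400000000 in
/-- Elements `292 ≤ h < 296`. -/
theorem levelsOK5_ok_292_296 : ∀ h : Fin 336, 292 ≤ h.val → h.val < 296 → levelsOK5n h.val = true := by decide +kernel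

set_option maxRecDepth 100000 in
set_option maxHeartbeats 400000000 in
/-- Elements `296 ≤ h < 300`. -/
theorem levelsOK5_ok_296_300 : ∀ h : Fin 336, 296 ≤ h.val → h.val < 300 → levelsOK5n h.val = true := by decide +kernel

set_option maxRecDepth 100000 in
set_option maxHeartbeats 400000000 in
/-- Elements `300 ≤ h < 304`. -/
theorem levelsOK5_ok_300_304 : ∀ h : Fin 336, 300 ≤ h.val → h.val < 304 → levelsOK5n h.val = true := by decide +kernel

set_option maxRecDepth 100000 in
set_option maxHeartbeats 400000000 in
/-- Elements `304 ≤ h < 308`. -/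
theorem levelsOK5_ok_304_308 : ∀ h : Fin 336, 304 ≤ h.val → h.val < 308 → levelsOK5n h.val = true := by decide +kernel

/-- CHECK A for the elements `280 ≤ h < 308`. -/
theorem levelsOK5_run_11 : ∀ h : Fin 336, 280 ≤ h.val → h.val < 308 → levelsOK5n h.val = true := by
  intro h hlo hhi
  by_cases h284 : h.val < 284
  · exact levelsOK5_ok_280_284 h (by omega) h284
  by_cases h288 : h.val < 288
  · exact levelsOK5_ok_284_288 h (by omega) h288
  by_cases h292 : h.val < 292
  · exact levelsOK5_ok_288_292 h (by omega) h292
  by_cases h296 : h.val < 296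
  · exact levelsOK5_ok_292_296 h (by omega) h296
  by_cases h300 : h.val < 300
  · exact levelsOK5_ok_296_300 h (by omega) h300
  by_cases h304 : h.val < 304
  · exact levelsOK5_ok_300_304 h (by omega) h304
  exact levelsOK5_ok_304_308 h (by omega) hhi

end Summit.MatrixMultiplication.OmegaCensus.SmallFormats
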